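import Literature.MathematicalPhysics.QuantumFieldTheory.Balaban1983to89.B6RandomWalkL2Local
import Literature.MathematicalPhysics.QuantumFieldTheory.Balaban1983to89.B9Eq360VprimeLetters

/-!
# `Balaban1983to89.B9Ineq361L2Letters` — [Balaban1985BackgroundPropagators] (3.60)–(3.61) p. 402, THE LOCAL LETTERS OF `V′(A)` IN BLOCK-`ℓ²`
# FORM: the vector-valued seam (a stencil-local operator on `𝔸`-valued lattice functions has a `B6RandomWalkL2.HasL2Majorant` after real
# coordinates), the coefficient letters `V¹_k = iad_A` and the zeroth-order letter `V⁰` of (3.52), and the averaging part of (3.60) (a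
# block-rank letter, through an `ℓ¹`-in-block seam) — the inputs the `ℓ²`-summed walk (3.64) needs for the `L²` members (3.46) of `G′(U′U)`

T. Bałaban, *Propagators for lattice gauge theories in a background field*, Commun. Math. Phys. **99** (1985) 389–434
[`Balaban1985BackgroundPropagators`, "B9"]; [4] = T. Bałaban, *Propagators and renormalization transformations for lattice gauge theories. II*,
Commun. Math. Phys. **96** (1984) 223–250 [`Balaban1984PropagatorsII`].

statement-level skeleton of published theorems with citation tags; proofs where landed; nothing here is a claim about the Yang–Mills mass gap

THE PRINTED LOCUS (verbatim).  (3.60)–(3.61) p. 402: *"Δ′_a(U′U) = Δ′_a(U) − V′(A), where the operator V′(A) is defined by the last equality. It is a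
sum of the operators considered above and we have |(V′(A)λ)(x)| ≤ O(1)α₁((Lʲη)⁻¹|(∇_Uλ)(·)| + (Lʲη)⁻²|λ(·)|) (3.61) with the norms on the
right-hand side restricted to the block Bʲ(y) containing the point x"*; (3.46) p. 398 (the `L²` members of Theorem 3.1); p. 403 l. 1–9 *"applying
Theorem 3.1 for G′(U), the bound (3.63), the representation (3.64) and Lemma 2.1 of [4] we can prove all the statements (3.42)–(3.47) of Theorem 3.1
for the operator G′(U′U)"*; [4] Prop. 2.6 p. 247: *"the series above is convergent in the norms appearing in the inequalities (2.136)–(2.140)"*.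

WHY THIS FILE (pub-ymgap N06 row 13: the `L²` steps DISPLAYED in `B9SectBStepFrameV2.SectBFrame₂`).  The tree's Sect.-B programme (seat r06) proves
(3.63) and the transfer of the SUP members (3.42) to `G′(U′U)` in the block-majorant calculus `B6RandomWalk.HasMajorant`; its letters enter through
the sup seam `B9Eq352DivFormLetters.hasMajorant_conj_of_local` and the pointwise sizes `B9Eq352GradLetters.norm_V0op_le_printed`,
`B9Eq360VprimeLetters.norm_avgOp_le`, `B9Eq360Vprime.norm_kerOp_le_avg`.  The `L²` members (3.46) want the same walk summed in the block-`ℓ²`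
calculus `B6RandomWalkL2` (print's own route; the kernel-form detour `B9Ineq346L2Final` is vacuous at the genuine geometry, lit-balaban desk
ME #13) — so every local letter of `V′(A)` needs a `HasL2Majorant`.  THIS FILE supplies them from the SAME pointwise inputs the sup programme
verified, through `B6RandomWalkL2Local.hasL2Majorant_of_local` (stencil-local letters: the `ℓ²` size is the sup size times `√(N·#ι)`, `N` the
stencil multiplicity) and a second seam for block-rank letters (`ℓ¹`-in-block bound + the printed volume factor `#Δ(y)·L^{−jd} ≦ 1`).

WHAT IS PROVED (0 sorry, 0 `def`, 0 new named facts; standard axioms).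
* §1 ★ `hasL2Majorant_conj_of_local` — the vector-valued `ℓ²` SEAM: `‖(Tf)(x)‖ ≦ c(y)·B` whenever `‖f‖ ≦ B` on the stencil of `x`, stencil
  multiplicity `≦ N`, range `≦ d₀` ⟹ `conj b T` has the block-`ℓ²` majorant `c(y)·M₂(Σ_i‖b_i‖)·√(N·#ι)·e^{δd₀}·e^{−δd(y,y′)}`.
* §2 ★ `hasL2Majorant_coefLetter` (the coefficient letters `iad_{A_μ}`, `iad_{τ*A_μ}`: pointwise multipliers, `N = 1`, size `2α₁ℓ⁻¹`),
  ★ `hasL2Majorant_V0op` (the zeroth-order letter of (3.52): nearest-neighbour stencil, `N ≦ 2|κ|+1`, size `(2 + 8ρ²α₁)|κ|α₁ℓ⁻²` as in the sup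
  programme) — the `ℓ²` twins of `B9Eq352GradLetters.hasMajorant_coefLetter` ∕ `hasMajorant_V0op`, same hypotheses.
* §3 `norm_coordSymm_apply_le_l2` (Cauchy–Schwarz on the synthesis side), ★ `hasL2Majorant_conj_of_blockSum` — the `ℓ¹`-IN-BLOCK SEAM:
  `‖(Tf)(x)‖ ≦ c(y)·w(y)·Σ_{x′∈Δ(y)}‖f(x′)‖` with `#Δ(y)·w(y) ≦ 1` ⟹ block-diagonal block-`ℓ²` majorant `𝟙[y = y′]·c(y)·M₂√#ι(Σ_i‖b_i‖²)^{1/2}`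
  (Cauchy–Schwarz twice; the volume of the block is absorbed by `#Δ(y)·w(y) ≦ 1`), ★ `hasL2Majorant_avgOp` — the averaging part of (3.60) in `ℓ²`
  (twin of `B9Eq360VprimeLetters.hasMajorant_avgOp'`, same hypotheses; the pointwise `ℓ¹`-in-block bound assembled from
  `B9Eq360Vprime.norm_kerOp_le_avg` for the three starred terms of `avgOp_apply`).

* §4 `hasL2Majorant_neg` ∕ `hasL2Majorant_sub` (signs), `hasL2Majorant_avgOp_decay` (the averaging part in the common decaying shape under
  `d(y,y) ≦ d₀`), ★ `hasL2Majorant_V0_vPrime` — `hV0` FOR THE FULL `V′(A)` IN ℓ²: `conj b V⁰ − conj b avgOp ≺₂ c″_C·α₁·ℓ⁻²·e^{−δd}` (twin of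
  `B9Eq360VprimeLetters.hasMajorant_V0_vPrime`, same hypotheses, `L²` constant `c″_C` explicit).

WHAT IS NOT HERE (the next bricks of the `ℓ²` route, successor items).  (i) the `L²` (3.63): `HasL2Majorant (conj b V′(A) * G′(U)) (O(1)α₁B₀·e^{−δ′d})`
from (3.46)₀,₁ at U — `hasL2Majorant_V0_vPrime` · (3.46)₀ + Σ_k `hasL2Majorant_coefLetter` · (3.46)₁ along
`B9Eq360VprimeLetters.conj_vPrimeConc_eq_gradForm` (`conj b V′ = (conj b V⁰ − conj b avgOp) + Σ_k conj b V¹_k · conj b ∇_k`) with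
`B6RandomWalkL2.hasL2Majorant_mul` and [4] Lemma 2.1 for the 𝔅-convolution; (ii) the (3.64) sum in `B6RandomWalkL2Chain` ⇒ (3.46)₀,₁ of
`G′(U′U)`; (iii) an `L2Frame₂` on the letters of `B9SectBGpStepAtLettersV2` and the first displayed steps `stepL2Gp 0∕1` framed.

HONEST SCOPE.  Finite-dimensional bookkeeping over the concrete letters of the tree's Sect.-B programme; no inequality of [B9] for Bałaban's
propagators is asserted (the propagator inputs (3.46) at U stay hypotheses of the sequel); count-neutral; NOT a node discharge; nothing
continuum ∕ OS ∕ mass-gap ∕ Clay.  Cell `pub-ymgap` (HUMAN RULING D-0062), Track A node N06 [B9], N06-ASSIGNMENT row 13 (the displayed `L²`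
steps), seat `pub-ymgap-dag-n06-c` (g4), 2026-08-27.

RELATED IN THE TREE, NOT DUPLICATED: `B6RandomWalkL2Local` (the real-carrier seam, this seat), `B9Eq352DivFormLetters` (`conj`, `coordEquiv`, the sup
seam), `B9Eq352GradLetters` (`coefLetter`, `V0op`, `norm_V0op_le_printed`, `hasMajorant_coefLetter` ∕ `hasMajorant_V0op` — the sup twins),
`B9Eq360VprimeLetters` (`avgOp`, `avgOp_apply`, `hasMajorant_avgOp'`), `B9Eq360Vprime` (`block`, `kerOp`, `norm_kerOp_le_avg`) — all USED BY NAME;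
no existing module modified.
-/

noncomputable section

open scoped BigOperators

namespace Literature.MathematicalPhysics.QuantumFieldTheory.Balaban1983to89.B9Ineq361L2Letters

open Literature.MathematicalPhysics.QuantumFieldTheory.Balaban1983to89
open Literature.MathematicalPhysics.QuantumFieldTheory.Balaban1983to89.B6RandomWalk (blockPiece)
open Literature.MathematicalPhysics.QuantumFieldTheory.Balaban1983to89.B6RandomWalkL2 (l2n HasL2Majorant hasL2Majorant_mono)
open Literature.MathematicalPhysics.QuantumFieldTheory.Balaban1983to89.B6RandomWalkL2Local (StencilLocal hasL2Majorant_of_local)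
open Literature.MathematicalPhysics.QuantumFieldTheory.Balaban1983to89.B9Thm34Ext (toB6)
open Literature.MathematicalPhysics.QuantumFieldTheory.Balaban1983to89.B9Eq352DivFormLetters (conj coordEquiv conj_apply
  norm_coordSymm_apply_le mulLetter mulLetter_apply)
open Literature.MathematicalPhysics.QuantumFieldTheory.Balaban1983to89.B9Eq352DivForm (tauB)
open Literature.MathematicalPhysics.QuantumFieldTheory.Balaban1983to89.B9Eq352GradLetters (coefLetter coefLetter_inl coefLetter_inr
  V0op norm_V0op_le_printed)
open Literature.MathematicalPhysics.QuantumFieldTheory.Balaban1983to89.B9Eq39Adjoint (covDstar)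
open Literature.MathematicalPhysics.QuantumFieldTheory.Balaban1983to89.Beta.BackgroundVertices (ad norm_ad_le)

/-! ## §1  The seam: a stencil-local operator on `E`-valued lattice functions has a block-ℓ² majorant after real coordinates -/

section Seam

variable {E : Type*} [NormedAddCommGroup E] [NormedSpace ℝ E] {ι : Type} [Fintype ι] [DecidableEq ι]
variable (b : Module.Basis ι ℝ E) {S : Type} [Fintype S] [DecidableEq S]
variable {g : B9.Geometry} [Fintype g.Site] {Rr : ℝ} {H : Prop}

/-- **THE ℓ² SEAM** (twin of `B9Eq352DivFormLetters.hasMajorant_conj_of_local`): if `‖(Tf)(x)‖ ≦ c(y)·B` whenever `‖f(x′)‖ ≦ B` at the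
stencil points `x′` of `x` (`y` the block of `x`, `c ≧ 0`), every point lies in the stencil of at most `N` points, the stencil of `x` lies in
blocks at `d`-distance `≦ d₀` from `y`, and `|b.repr v i| ≦ M₂‖v‖`, then for every `δ ≧ 0` the conjugated operator on the real-coordinate
carrier `S × ι` has the BLOCK-ℓ² majorant `c(y)·M₂(Σ_i‖b_i‖)·√(N·#ι)·e^{δd₀}·e^{−δd(y,y′)}` — the shape (2.140) of [4] for a local letter.
Proof: `B6RandomWalkL2Local.hasL2Majorant_of_local` on `S × ι` with the stencil `(x,i) ~ (x′,j) :⟺ x ~ x′` (multiplicity `N·#ι`) and the two norm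
comparisons of the sup seam. [cite: Balaban1984PropagatorsII, (2.51) p.232 + Prop. 2.6 (2.140) p.247; Balaban1985BackgroundPropagators, (3.61) p.402; derivation ours] -/
theorem hasL2Majorant_conj_of_local (blk : S → g.Site) (near : S → S → Prop) (c : g.Site → ℝ) (d₀ δ M₂ : ℝ) (N : ℕ)
    (hc : ∀ a, 0 ≤ c a) (hδ : 0 ≤ δ) (hM₂ : 0 ≤ M₂) (hrepr : ∀ (v : E) (i : ι), |b.repr v i| ≤ M₂ * ‖v‖)
    (hnear : ∀ x x', near x x' → g.dist (blk x) (blk x') ≤ d₀)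
    (hmult : ∀ x' : S, ∃ s : Finset S, (s.card : ℝ) ≤ N ∧ ∀ x, near x x' → x ∈ s)
    (T : Module.End ℝ (S → E))
    (hT : ∀ (f : S → E) (x : S) (B : ℝ), (∀ x', near x x' → ‖f x'‖ ≤ B) → ‖T f x‖ ≤ c (blk x) * B) :
    HasL2Majorant (g := toB6 g Rr H) (fun p : S × ι => blk p.1) (conj b T)
      (fun a a' => c a * (M₂ * ∑ i, ‖b i‖) * Real.sqrt ((N * Fintype.card ι : ℕ) : ℝ) * Real.exp (δ * d₀) *
        Real.exp (-(δ * g.dist a a'))) := by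
  have hSb : 0 ≤ ∑ i, ‖b i‖ := Finset.sum_nonneg fun i _ => norm_nonneg _
  refine hasL2Majorant_of_local (g := toB6 g Rr H) (fun p : S × ι => blk p.1) (fun p q : S × ι => near p.1 q.1)
    (fun a => c a * (M₂ * ∑ i, ‖b i‖)) d₀ δ (N * Fintype.card ι) (fun a => mul_nonneg (hc a) (mul_nonneg hM₂ hSb)) hδ
    (fun p q hpq => hnear p.1 q.1 hpq) ?_ ?_
  · -- multiplicity on the product carrier: the covering finset `s ×ˢ univ`
    intro q
    obtain ⟨s, hs, hcover⟩ := hmult q.1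
    refine ⟨s ×ˢ (Finset.univ : Finset ι), ?_, fun p hp => Finset.mem_product.2 ⟨hcover p.1 hp, Finset.mem_univ _⟩⟩
    rw [Finset.card_product, Finset.card_univ, Nat.cast_mul, Nat.cast_mul]
    exact mul_le_mul_of_nonneg_right hs (Nat.cast_nonneg _)
  · -- the sup-stencil bound of the conjugated operator (as in the sup seam)
    intro μ p B hB
    have hf : ∀ x', near p.1 x' → ‖(coordEquiv b).symm μ x'‖ ≤ (∑ i, ‖b i‖) * B := fun x' hx' =>
      norm_coordSymm_apply_le b μ x' B fun i => hB (x', i) hx'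
    have h1 : ‖T ((coordEquiv b).symm μ) p.1‖ ≤ c (blk p.1) * ((∑ i, ‖b i‖) * B) := hT _ p.1 _ hf
    rw [conj_apply]
    calc |b.repr (T ((coordEquiv b).symm μ) p.1) p.2|
        ≤ M₂ * ‖T ((coordEquiv b).symm μ) p.1‖ := hrepr _ _
      _ ≤ M₂ * (c (blk p.1) * ((∑ i, ‖b i‖) * B)) := mul_le_mul_of_nonneg_left h1 hM₂
      _ = c (blk p.1) * (M₂ * ∑ i, ‖b i‖) * B := by ring

end Seam

/-! ## §2  The coefficient letters `V¹_k = iad_{A}` and the zeroth-order letter `V⁰` of (3.52) in block-ℓ² form -/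

section Letters

variable {𝔸 : Type*} [NormedRing 𝔸] [NormedAlgebra ℂ 𝔸] [CompleteSpace 𝔸] {ι : Type} [Fintype ι] [DecidableEq ι]
variable (b : Module.Basis ι ℝ 𝔸) {S : Type} [Fintype S] [DecidableEq S] {κ : Type} [Fintype κ]
variable (T : κ → Equiv.Perm S) (U : κ → S → 𝔸ˣ)
variable {g : B9.Geometry} [Fintype g.Site] {Rr : ℝ} {H : Prop}

omit [CompleteSpace 𝔸] [Fintype κ] in
/-- **THE COEFFICIENT LETTERS IN ℓ²** (twin of `B9Eq352GradLetters.hasMajorant_coefLetter`): under (3.37) read blockwise for the coefficients as they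
occur (`‖A_μ(x)‖, ‖τ*_μA_μ(x)‖ ≦ α₁ℓ⁻¹`) and `d(y,y) ≦ d₀`: `conj b (coefLetter A k)` has the block-ℓ² majorant
`2M₂(Σ_i‖b_i‖)√#ι·e^{δd₀}·α₁·ℓ⁻¹·e^{−δd(y,y′)}` for every bond letter `k` — a POINTWISE multiplier (stencil = the point itself, multiplicity 1),
so the ℓ² size is the sup size. [cite: Balaban1985BackgroundPropagators, (3.52) p.400 + (3.61) p.402 + (3.37) p.396; Balaban1984PropagatorsII, Prop. 2.6 (2.140) p.247; derivation ours] -/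
theorem hasL2Majorant_coefLetter (blk : S → g.Site) (A : κ → S → 𝔸) (d₀ δ M₂ α₁ : ℝ)
    (hα₁ : 0 ≤ α₁) (hδ : 0 ≤ δ) (hM₂ : 0 ≤ M₂) (hrepr : ∀ (v : 𝔸) (i : ι), |b.repr v i| ≤ M₂ * ‖v‖)
    (hlen : ∀ y : g.Site, 0 < g.len y)
    (hA : ∀ μ x, ‖A μ x‖ ≤ α₁ * (g.len (blk x))⁻¹ ∧ ‖tauB T U μ (A μ) x‖ ≤ α₁ * (g.len (blk x))⁻¹)
    (hd₀0 : ∀ y : g.Site, g.dist y y ≤ d₀) (k : κ ⊕ κ) :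
    HasL2Majorant (g := toB6 g Rr H) (fun p : S × ι => blk p.1) (conj b (coefLetter T U A k))
      (fun y y' => (2 * M₂ * (∑ i, ‖b i‖) * Real.sqrt ((1 * Fintype.card ι : ℕ) : ℝ) * Real.exp (δ * d₀)) * α₁ * (g.len y)⁻¹ *
        Real.exp (-(δ * g.dist y y'))) := by
  -- a pointwise coefficient letter `iad_{a}` with `‖a(x)‖ ≦ α₁ℓ⁻¹`
  have key : ∀ a : S → 𝔸, (∀ x, ‖a x‖ ≤ α₁ * (g.len (blk x))⁻¹) →
      HasL2Majorant (g := toB6 g Rr H) (fun p : S × ι => blk p.1) (conj b (mulLetter a))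
        (fun y y' => (2 * M₂ * (∑ i, ‖b i‖) * Real.sqrt ((1 * Fintype.card ι : ℕ) : ℝ) * Real.exp (δ * d₀)) * α₁ *
          (g.len y)⁻¹ * Real.exp (-(δ * g.dist y y'))) := by
    intro a ha
    have hc0 : ∀ y : g.Site, 0 ≤ 2 * α₁ * (g.len y)⁻¹ := fun y => by have := hlen y; positivity
    refine hasL2Majorant_mono (g := toB6 g Rr H) _
      (hasL2Majorant_conj_of_local (Rr := Rr) (H := H) b blk (fun x x' => x' = x) (fun y => 2 * α₁ * (g.len y)⁻¹) d₀ δ M₂ 1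
        hc0 hδ hM₂ hrepr (fun x x' hx' => by rw [hx']; exact hd₀0 _)
        (fun x' => ⟨{x'}, by simp, fun x hx => by rw [Finset.mem_singleton]; exact hx.symm⟩) (mulLetter a) ?_)
      fun y y' => le_of_eq ?_
    · intro f x B hB
      have hB' : ‖f x‖ ≤ B := hB x rfl
      rw [mulLetter_apply, norm_smul, Complex.norm_I, one_mul]
      calc ‖ad (a x) (f x)‖ ≤ 2 * ‖a x‖ * ‖f x‖ := norm_ad_le _ _
        _ ≤ 2 * (α₁ * (g.len (blk x))⁻¹) * B := by
            have h0 : 0 ≤ α₁ * (g.len (blk x))⁻¹ := mul_nonneg hα₁ (inv_nonneg.mpr (hlen _).le)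
            have := ha x
            gcongr
        _ = 2 * α₁ * (g.len (blk x))⁻¹ * B := by ring
    · ring
  cases k with
  | inl μ => rw [coefLetter_inl]; exact key (A μ) fun x => (hA μ x).1
  | inr μ => rw [coefLetter_inr]; exact key (tauB T U μ (A μ)) fun x => (hA μ x).2

/-- **THE ZEROTH-ORDER LETTER `V⁰` OF (3.52) IN ℓ²** (twin of `B9Eq352GradLetters.hasMajorant_V0op`): under (3.37) read blockwise for the letters as they
occur, `ηα₁ℓ⁻¹ ≦ 1/4`, transports of size `≦ ρ`, the star of every `x` in blocks at `d`-distance `≦ d₀`: `conj b (V0op η A)` has the block-ℓ²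
majorant `c_C·√((2|κ|+1)·#ι)·α₁·ℓ⁻²·e^{−δd(y,y′)}`, `c_C = (2 + 8ρ²α₁)·|κ|·M₂(Σ_i‖b_i‖)·e^{δd₀}` — a nearest-neighbour stencil (multiplicity `≦ 2|κ|+1`),
pointwise size `norm_V0op_le_printed` exactly as in the sup programme. [cite: Balaban1985BackgroundPropagators, (3.52) p.400 + (3.54) p.401 + (3.61) p.402 + (3.37) p.396; Balaban1984PropagatorsII, Prop. 2.6 (2.140) p.247; derivation ours] -/
theorem hasL2Majorant_V0op (blk : S → g.Site) {η : ℝ} (hη : 0 < η) (A : κ → S → 𝔸) (ρ d₀ δ M₂ α₁ : ℝ)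
    (hα₁ : 0 ≤ α₁) (hδ : 0 ≤ δ) (hM₂ : 0 ≤ M₂) (hrepr : ∀ (v : 𝔸) (i : ι), |b.repr v i| ≤ M₂ * ‖v‖)
    (hlen : ∀ y : g.Site, 0 < g.len y) (hsmall : ∀ y : g.Site, η * (α₁ * (g.len y)⁻¹) ≤ 1 / 4)
    (hA : ∀ μ x, ‖A μ x‖ ≤ α₁ * (g.len (blk x))⁻¹ ∧ ‖tauB T U μ (A μ) x‖ ≤ α₁ * (g.len (blk x))⁻¹)
    (h337s : ∀ μ x, ‖((η : ℂ)⁻¹) • covDstar T U μ (A μ) x‖ ≤ α₁ * (g.len (blk x) ^ 2)⁻¹)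
    (hρ : ∀ μ x, ‖((U μ x : 𝔸ˣ) : 𝔸)‖ ≤ ρ ∧ ‖(((U μ x)⁻¹ : 𝔸ˣ) : 𝔸)‖ ≤ ρ)
    (hd₀ : ∀ μ x, g.dist (blk x) (blk (T μ x)) ≤ d₀ ∧ g.dist (blk x) (blk ((T μ).symm x)) ≤ d₀)
    (hd₀0 : ∀ y : g.Site, g.dist y y ≤ d₀) :
    HasL2Majorant (g := toB6 g Rr H) (fun p : S × ι => blk p.1) (conj b (V0op T U η A))
      (fun y y' => ((2 + 8 * ρ ^ 2 * α₁) * Fintype.card κ * M₂ * (∑ i, ‖b i‖) *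
          Real.sqrt (((2 * Fintype.card κ + 1) * Fintype.card ι : ℕ) : ℝ) * Real.exp (δ * d₀)) * α₁ * (g.len y ^ 2)⁻¹ *
        Real.exp (-(δ * g.dist y y'))) := by
  classical
  have hd : (0 : ℝ) ≤ Fintype.card κ := Nat.cast_nonneg _
  have hc0 : ∀ y : g.Site, 0 ≤ (2 + 8 * ρ ^ 2 * α₁) * Fintype.card κ * α₁ * (g.len y ^ 2)⁻¹ := fun y => by positivity
  refine hasL2Majorant_mono (g := toB6 g Rr H) _
    (hasL2Majorant_conj_of_local (Rr := Rr) (H := H) b blk (fun x x' => x' = x ∨ ∃ μ, x' = T μ x ∨ x' = (T μ).symm x)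
      (fun y => (2 + 8 * ρ ^ 2 * α₁) * Fintype.card κ * α₁ * (g.len y ^ 2)⁻¹) d₀ δ M₂ (2 * Fintype.card κ + 1) hc0 hδ hM₂ hrepr ?_ ?_
      (V0op T U η A) ?_) fun y y' => le_of_eq ?_
  · rintro x x' (rfl | ⟨μ, rfl | rfl⟩)
    · exact hd₀0 _
    · exact (hd₀ μ x).1
    · exact (hd₀ μ x).2
  · -- the nearest-neighbour stencil has multiplicity ≦ 2|κ| + 1
    intro x'
    refine ⟨insert x' (Finset.univ.image (fun μ => (T μ).symm x') ∪ Finset.univ.image (fun μ => T μ x')), ?_, ?_⟩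
    · have h1 := Finset.card_insert_le x' (Finset.univ.image (fun μ => (T μ).symm x') ∪ Finset.univ.image (fun μ => T μ x'))
      have h2 := Finset.card_union_le (Finset.univ.image (fun μ => (T μ).symm x')) (Finset.univ.image (fun μ => T μ x'))
      have h3 : (Finset.univ.image (fun μ => (T μ).symm x')).card ≤ Fintype.card κ := Finset.card_image_le.trans (by simp)
      have h4 : (Finset.univ.image (fun μ => T μ x')).card ≤ Fintype.card κ := Finset.card_image_le.trans (by simp)
      have : (insert x' (Finset.univ.image (fun μ => (T μ).symm x') ∪ Finset.univ.image (fun μ => T μ x'))).card ≤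
          2 * Fintype.card κ + 1 := by omega
      exact_mod_cast this
    · rintro x (rfl | ⟨μ, h | h⟩)
      · exact Finset.mem_insert_self _ _
      · refine Finset.mem_insert_of_mem (Finset.mem_union_left _ (Finset.mem_image.2 ⟨μ, Finset.mem_univ _, ?_⟩))
        rw [h]; simp
      · refine Finset.mem_insert_of_mem (Finset.mem_union_right _ (Finset.mem_image.2 ⟨μ, Finset.mem_univ _, ?_⟩))
        rw [h]; simp
  · intro f x B hB
    exact norm_V0op_le_printed T U hη A f x hα₁ (hlen _) (hsmall _) (fun μ => hA μ x) (fun μ => h337s μ x)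
      (fun μ => ⟨hρ μ x, hρ μ ((T μ).symm x)⟩) (hB x (Or.inl rfl))
      (fun μ => ⟨hB _ (Or.inr ⟨μ, Or.inl rfl⟩), hB _ (Or.inr ⟨μ, Or.inr rfl⟩)⟩)
  · ring

end Letters

/-! ## §3  The averaging letter of (3.60) (a block-rank operator) in block-ℓ² form: the ℓ¹-in-block seam -/

section BlockSum

variable {E : Type*} [NormedAddCommGroup E] [NormedSpace ℝ E] {ι : Type} [Fintype ι]
variable (b : Module.Basis ι ℝ E) {S : Type} [Fintype S]
variable {g : B9.Geometry} [Fintype g.Site] [DecidableEq g.Site] {Rr : ℝ} {H : Prop}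

omit [Fintype S] [Fintype g.Site] [DecidableEq g.Site] in
/-- Cauchy–Schwarz for the synthesis side in ℓ²: `‖Σ_i μ_i b_i‖ ≦ (Σ_i‖b_i‖²)^{1/2}·(Σ_i μ_i²)^{1/2}`.
[cite: Balaban1984PropagatorsII, (2.51) p.232 (bookkeeping, ours)] -/
theorem norm_coordSymm_apply_le_l2 (μ : S × ι → ℝ) (x : S) :
    ‖(coordEquiv b).symm μ x‖ ≤ Real.sqrt (∑ i, ‖b i‖ ^ 2) * Real.sqrt (∑ i, μ (x, i) ^ 2) := by
  rw [B9Eq352DivFormLetters.coordEquiv_symm_apply]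
  calc ‖∑ i, μ (x, i) • b i‖ ≤ ∑ i, ‖μ (x, i) • b i‖ := norm_sum_le _ _
    _ = ∑ i, ‖b i‖ * |μ (x, i)| := Finset.sum_congr rfl fun i _ => by rw [norm_smul, Real.norm_eq_abs, mul_comm]
    _ ≤ Real.sqrt (∑ i, ‖b i‖ ^ 2) * Real.sqrt (∑ i, |μ (x, i)| ^ 2) :=
        Real.sum_mul_le_sqrt_mul_sqrt _ _ _
    _ = Real.sqrt (∑ i, ‖b i‖ ^ 2) * Real.sqrt (∑ i, μ (x, i) ^ 2) := by simp only [sq_abs]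

/-- **THE ℓ¹-IN-BLOCK SEAM** (for block-rank letters such as the averaging part of (3.60)): if `‖(Tf)(x)‖ ≦ c(y)·w(y)·Σ_{x′∈Δ(y)}‖f(x′)‖`
(`y` the block of `x`, `c, w ≧ 0`, `#Δ(y)·w(y) ≦ 1` — print's `w = L^{−jd}`), then after real coordinates `T` has the BLOCK-DIAGONAL block-ℓ²
majorant `𝟙[y = y′]·c(y)·M₂·√#ι·(Σ_i‖b_i‖²)^{1/2}` (Cauchy–Schwarz twice; the factor `#Δ(y)·w(y) ≦ 1` absorbs the block volume, so no
stencil multiplicity enters). [cite: Balaban1985BackgroundPropagators, (3.60)–(3.61) p.402 + (3.19) p.393; Balaban1984PropagatorsII, Prop. 2.6 (2.140) p.247; derivation ours] -/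
theorem hasL2Majorant_conj_of_blockSum (blk : S → g.Site) (c w : g.Site → ℝ) (M₂ : ℝ)
    (hc : ∀ a, 0 ≤ c a) (hw : ∀ a, 0 ≤ w a) (hM₂ : 0 ≤ M₂) (hrepr : ∀ (v : E) (i : ι), |b.repr v i| ≤ M₂ * ‖v‖)
    (hcard : ∀ y, ((B9Eq360Vprime.block blk y).card : ℝ) * w y ≤ 1) (T : Module.End ℝ (S → E))
    (hT : ∀ (f : S → E) (x : S), ‖T f x‖ ≤ c (blk x) * (w (blk x) * ∑ x' ∈ B9Eq360Vprime.block blk (blk x), ‖f x'‖)) :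
    HasL2Majorant (g := toB6 g Rr H) (fun p : S × ι => blk p.1) (conj b T)
      (fun a a' : g.Site => if a = a' then c a * M₂ * Real.sqrt (Fintype.card ι) * Real.sqrt (∑ i, ‖b i‖ ^ 2) else 0) := by
  classical
  intro y y' u hu
  change g.Site at y y'
  set f : S → E := (coordEquiv b).symm u with hf
  set β : ℝ := Real.sqrt (∑ i, ‖b i‖ ^ 2) with hβ
  have hβ0 : 0 ≤ β := Real.sqrt_nonneg _
  have hL0 : 0 ≤ l2n u := B6RandomWalkL2.l2n_nonneg u
  -- the coordinates of one site: ‖f x′‖ ≤ β·n(x′), n(x′)² = Σ_i u(x′,i)²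
  set n : S → ℝ := fun x' => Real.sqrt (∑ i, u (x', i) ^ 2) with hn
  have hn0 : ∀ x', 0 ≤ n x' := fun x' => Real.sqrt_nonneg _
  have hnsq : ∀ x', n x' ^ 2 = ∑ i, u (x', i) ^ 2 := fun x' => Real.sq_sqrt (Finset.sum_nonneg fun _ _ => sq_nonneg _)
  have hfx : ∀ x', ‖f x'‖ ≤ β * n x' := fun x' => norm_coordSymm_apply_le_l2 b u x'
  have hn_off : ∀ x', blk x' ≠ y' → n x' = 0 := fun x' hx' => by
    have : ∀ i, u (x', i) = 0 := fun i => hu (x', i) hx'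
    simp [hn, this]
  -- the block sum S_y := Σ_{x′∈Δ(y)} ‖f x′‖ and its square: S_y² ≤ β²·#Δ(y)·‖u‖²
  set Sy : ℝ := ∑ x' ∈ B9Eq360Vprime.block blk y, ‖f x'‖ with hSy
  have hSy0 : 0 ≤ Sy := Finset.sum_nonneg fun _ _ => norm_nonneg _
  have hsum_n_sq : ∑ x' ∈ B9Eq360Vprime.block blk y, n x' ^ 2 ≤ l2n u ^ 2 := by
    rw [B6RandomWalkL2.l2n_sq]
    calc ∑ x' ∈ B9Eq360Vprime.block blk y, n x' ^ 2
        = ∑ x' ∈ B9Eq360Vprime.block blk y, ∑ i, u (x', i) ^ 2 := Finset.sum_congr rfl fun x' _ => hnsq x'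
      _ ≤ ∑ x' : S, ∑ i, u (x', i) ^ 2 :=
          Finset.sum_le_sum_of_subset_of_nonneg (Finset.subset_univ _) fun _ _ _ => Finset.sum_nonneg fun _ _ => sq_nonneg _
      _ = ∑ p : S × ι, u p ^ 2 := by rw [← Finset.univ_product_univ, Finset.sum_product]
  have hSy_le : Sy ≤ β * ∑ x' ∈ B9Eq360Vprime.block blk y, 1 * n x' := by
    rw [hSy, Finset.mul_sum]
    exact Finset.sum_le_sum fun x' _ => by rw [one_mul]; exact hfx x'
  have hcs : (∑ x' ∈ B9Eq360Vprime.block blk y, 1 * n x') ^ 2 ≤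
      ((B9Eq360Vprime.block blk y).card : ℝ) * l2n u ^ 2 := by
    have h := Finset.sum_mul_sq_le_sq_mul_sq (B9Eq360Vprime.block blk y) (fun _ => (1 : ℝ)) n
    simp only [one_pow, Finset.sum_const, nsmul_eq_mul, mul_one] at h
    exact h.trans (mul_le_mul_of_nonneg_left hsum_n_sq (Nat.cast_nonneg _))
  have hSy_sq : Sy ^ 2 ≤ β ^ 2 * (((B9Eq360Vprime.block blk y).card : ℝ) * l2n u ^ 2) := by
    have h1 : Sy ^ 2 ≤ (β * ∑ x' ∈ B9Eq360Vprime.block blk y, 1 * n x') ^ 2 := pow_le_pow_left₀ hSy0 hSy_le 2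
    rw [mul_pow] at h1
    exact h1.trans (mul_le_mul_of_nonneg_left hcs (sq_nonneg _))
  -- pointwise: |conj T u (x,i)| ≤ K := M₂·c(y)·w(y)·S_y for x ∈ Δ(y)
  set K : ℝ := M₂ * (c y * (w y * Sy)) with hK
  have hK0 : 0 ≤ K := mul_nonneg hM₂ (mul_nonneg (hc y) (mul_nonneg (hw y) hSy0))
  have hpt : ∀ p : S × ι, blk p.1 = y → |conj b T u p| ≤ K := by
    intro p hp
    rw [conj_apply]
    calc |b.repr (T f p.1) p.2| ≤ M₂ * ‖T f p.1‖ := hrepr _ _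
      _ ≤ M₂ * (c (blk p.1) * (w (blk p.1) * ∑ x' ∈ B9Eq360Vprime.block blk (blk p.1), ‖f x'‖)) :=
          mul_le_mul_of_nonneg_left (hT f p.1) hM₂
      _ = K := by rw [hp]
  -- the square of the piece: ≤ #Δ(y)·#ι·K²
  have hsq : l2n (blockPiece (g := toB6 g Rr H) (fun p : S × ι => blk p.1) y (conj b T u)) ^ 2 ≤
      (((B9Eq360Vprime.block blk y).card : ℝ) * Fintype.card ι) * K ^ 2 := by
    rw [B6RandomWalkL2.l2n_sq]
    calc ∑ p : S × ι, (blockPiece (g := toB6 g Rr H) (fun p : S × ι => blk p.1) y (conj b T u) p) ^ 2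
        = ∑ p : S × ι, (if blk p.1 = y then (conj b T u p) ^ 2 else 0) := Finset.sum_congr rfl fun p _ => by
            by_cases hp : blk p.1 = y <;> simp [blockPiece, hp]
      _ ≤ ∑ p : S × ι, (if blk p.1 = y then K ^ 2 else 0) := Finset.sum_le_sum fun p _ => by
            by_cases hp : blk p.1 = y
            · rw [if_pos hp, if_pos hp]
              calc (conj b T u p) ^ 2 = |conj b T u p| ^ 2 := (sq_abs _).symm
                _ ≤ K ^ 2 := pow_le_pow_left₀ (abs_nonneg _) (hpt p hp) 2
            · rw [if_neg hp, if_neg hp]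
      _ = ((Finset.univ.filter fun p : S × ι => blk p.1 = y).card : ℝ) * K ^ 2 := by
            rw [Finset.sum_ite, Finset.sum_const_zero, add_zero, Finset.sum_const, nsmul_eq_mul]
      _ = (((B9Eq360Vprime.block blk y).card : ℝ) * Fintype.card ι) * K ^ 2 := by
            congr 1
            have : (Finset.univ.filter fun p : S × ι => blk p.1 = y) = B9Eq360Vprime.block blk y ×ˢ Finset.univ := by
              ext p; simp [B9Eq360Vprime.mem_block]
            rw [this, Finset.card_product, Finset.card_univ, Nat.cast_mul]
  -- … ≤ (c·M₂·√#ι·β·‖u‖)², using (#Δ·w)² ≤ 1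
  have hvol : ((B9Eq360Vprime.block blk y).card : ℝ) * w y ≤ 1 := hcard y
  have hvol0 : 0 ≤ ((B9Eq360Vprime.block blk y).card : ℝ) * w y := mul_nonneg (Nat.cast_nonneg _) (hw y)
  have hvol2 : (((B9Eq360Vprime.block blk y).card : ℝ) * w y) ^ 2 ≤ 1 := by nlinarith
  have hι0 : (0 : ℝ) ≤ Fintype.card ι := Nat.cast_nonneg _
  have htarget : (((B9Eq360Vprime.block blk y).card : ℝ) * Fintype.card ι) * K ^ 2 ≤
      (c y * M₂ * Real.sqrt (Fintype.card ι) * β * l2n u) ^ 2 := by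
    have e1 : (c y * M₂ * Real.sqrt (Fintype.card ι) * β * l2n u) ^ 2 = (Fintype.card ι : ℝ) * (M₂ * c y * β * l2n u) ^ 2 := by
      rw [show c y * M₂ * Real.sqrt (Fintype.card ι) * β * l2n u = Real.sqrt (Fintype.card ι) * (M₂ * c y * β * l2n u) by ring,
        mul_pow, Real.sq_sqrt hι0]
    have hA : 0 ≤ (Fintype.card ι : ℝ) * (M₂ * c y) ^ 2 * (w y ^ 2 * ((B9Eq360Vprime.block blk y).card : ℝ)) := by
      have := hc y; have := hw y; positivity
    have hB : 0 ≤ (Fintype.card ι : ℝ) * (M₂ * c y * β * l2n u) ^ 2 := by positivity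
    calc (((B9Eq360Vprime.block blk y).card : ℝ) * Fintype.card ι) * K ^ 2
        = (Fintype.card ι : ℝ) * (M₂ * c y) ^ 2 * (w y ^ 2 * ((B9Eq360Vprime.block blk y).card : ℝ)) * Sy ^ 2 := by
            rw [hK]; ring
      _ ≤ (Fintype.card ι : ℝ) * (M₂ * c y) ^ 2 * (w y ^ 2 * ((B9Eq360Vprime.block blk y).card : ℝ)) *
            (β ^ 2 * (((B9Eq360Vprime.block blk y).card : ℝ) * l2n u ^ 2)) := mul_le_mul_of_nonneg_left hSy_sq hA
      _ = (Fintype.card ι : ℝ) * (M₂ * c y * β * l2n u) ^ 2 * (((B9Eq360Vprime.block blk y).card : ℝ) * w y) ^ 2 := by ring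
      _ ≤ (Fintype.card ι : ℝ) * (M₂ * c y * β * l2n u) ^ 2 * 1 := mul_le_mul_of_nonneg_left hvol2 hB
      _ = (c y * M₂ * Real.sqrt (Fintype.card ι) * β * l2n u) ^ 2 := by rw [e1, mul_one]
  have h0 : 0 ≤ c y * M₂ * Real.sqrt (Fintype.card ι) * β * l2n u := by
    have := hc y; positivity
  have hmain : l2n (blockPiece (g := toB6 g Rr H) (fun p : S × ι => blk p.1) y (conj b T u)) ≤ c y * M₂ * Real.sqrt (Fintype.card ι) * β * l2n u := by
    have := Real.sqrt_le_sqrt (hsq.trans htarget)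
    rwa [Real.sqrt_sq (B6RandomWalkL2.l2n_nonneg _), Real.sqrt_sq h0] at this
  beta_reduce
  by_cases hyy : y = y'
  · rw [if_pos hyy]
    simpa only [hβ] using hmain
  · -- y ≠ y′: the piece vanishes (f = 0 on Δ(y), so S_y = 0 and K = 0)
    rw [if_neg hyy, zero_mul]
    have hSy_zero : Sy = 0 := by
      refine le_antisymm ?_ hSy0
      rw [hSy]
      refine (Finset.sum_le_sum fun x' hx' => ?_).trans (le_of_eq Finset.sum_const_zero)
      rw [B9Eq360Vprime.mem_block] at hx'
      have hx'' : blk x' ≠ y' := by rw [hx']; exact hyy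
      calc ‖f x'‖ ≤ β * n x' := hfx x'
        _ = 0 := by rw [hn_off x' hx'', mul_zero]
    have hK_zero : K = 0 := by rw [hK, hSy_zero, mul_zero, mul_zero, mul_zero]
    have h' : l2n (blockPiece (g := toB6 g Rr H) (fun p : S × ι => blk p.1) y (conj b T u)) ^ 2 ≤ 0 := by
      have := hsq; rw [hK_zero] at this; simpa using this
    have : l2n (blockPiece (g := toB6 g Rr H) (fun p : S × ι => blk p.1) y (conj b T u)) = 0 :=
      le_antisymm (by nlinarith [B6RandomWalkL2.l2n_nonneg (blockPiece (g := toB6 g Rr H) (fun p : S × ι => blk p.1) y (conj b T u))])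
        (B6RandomWalkL2.l2n_nonneg _)
    rw [this]

/-- **THE AVERAGING PART OF (3.60) IN ℓ²** (twin of `B9Eq360VprimeLetters.hasMajorant_avgOp'`): under the (3.19)∕(3.58)∕(3.24)-shape bounds of the
averaging letters (`‖kQ y x‖ ≦ w(y)` with `#Δ(y)·w(y) ≦ 1`, `‖kF y x‖ ≦ Cα₁w(y)`, `‖sQ‖ ≦ 1`, `‖sF‖ ≦ Cα₁`, `|c(y)| ≦ a₀ℓ(y)⁻²`):
`conj b avgOp` has the block-diagonal block-ℓ² majorant `𝟙[y = y′]·a₀C(2 + Cα₁)·α₁·ℓ(y)⁻²·M₂√#ι(Σ_i‖b_i‖²)^{1/2}` — via the ℓ¹-in-block seam and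
`B9Eq360Vprime.norm_kerOp_le_avg`. [cite: Balaban1985BackgroundPropagators, (3.60)–(3.61) p.402 + (3.19) p.393 + (3.58)–(3.59) p.402 + (3.24) p.394; Balaban1984PropagatorsII, Prop. 2.6 (2.140) p.247; derivation ours] -/
theorem hasL2Majorant_avgOp (blk : S → g.Site) (kQ kF : g.Site → S → E →L[ℝ] E) (sQ sF : S → E →L[ℝ] E)
    (c w : g.Site → ℝ) (C α₁ a₀ M₂ : ℝ) (hw : ∀ y, 0 ≤ w y) (hcard : ∀ y, ((B9Eq360Vprime.block blk y).card : ℝ) * w y ≤ 1)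
    (hC : 0 ≤ C) (hα : 0 ≤ α₁) (ha₀ : 0 ≤ a₀) (hM₂ : 0 ≤ M₂) (hrepr : ∀ (v : E) (i : ι), |b.repr v i| ≤ M₂ * ‖v‖)
    (hlen : ∀ y : g.Site, 0 < g.len y)
    (hkQ : ∀ y x, blk x = y → ‖kQ y x‖ ≤ w y) (hkF : ∀ y x, blk x = y → ‖kF y x‖ ≤ C * α₁ * w y)
    (hsQ : ∀ x, ‖sQ x‖ ≤ 1) (hsF : ∀ x, ‖sF x‖ ≤ C * α₁) (hc : ∀ y, |c y| ≤ a₀ * (g.len y ^ 2)⁻¹) :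
    HasL2Majorant (g := toB6 g Rr H) (fun p : S × ι => blk p.1) (conj b (B9Eq360VprimeLetters.avgOp blk kQ kF sQ sF c))
      (fun a a' : g.Site => if a = a' then a₀ * C * (2 + C * α₁) * α₁ * (g.len a ^ 2)⁻¹ * M₂ * Real.sqrt (Fintype.card ι) *
        Real.sqrt (∑ i, ‖b i‖ ^ 2) else 0) := by
  have hc0 : ∀ y : g.Site, 0 ≤ a₀ * C * (2 + C * α₁) * α₁ * (g.len y ^ 2)⁻¹ := fun y => by
    have := hlen y; positivity
  refine hasL2Majorant_conj_of_blockSum (Rr := Rr) (H := H) b blk (fun a => a₀ * C * (2 + C * α₁) * α₁ * (g.len a ^ 2)⁻¹) w M₂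
    hc0 hw hM₂ hrepr hcard _ fun f x => ?_
  -- the ℓ¹-in-block pointwise bound of the three starred terms
  have hQ := B9Eq360Vprime.norm_kerOp_le_avg blk kQ f (blk x) (C := 1) w (fun x' hx' => by rw [one_mul]; exact hkQ _ x' hx')
  have hF := B9Eq360Vprime.norm_kerOp_le_avg blk kF f (blk x) (C := C * α₁) w (fun x' hx' => hkF _ x' hx')
  set Sw : ℝ := ∑ x' ∈ B9Eq360Vprime.block blk (blk x), w (blk x) * ‖f x'‖ with hSw
  have hSw0 : 0 ≤ Sw := Finset.sum_nonneg fun _ _ => mul_nonneg (hw _) (norm_nonneg _)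
  have hSweq : w (blk x) * ∑ x' ∈ B9Eq360Vprime.block blk (blk x), ‖f x'‖ = Sw := by rw [hSw, Finset.mul_sum]
  have hcy := hc (blk x)
  have hCα : 0 ≤ C * α₁ := mul_nonneg hC hα
  have term : ∀ (s : S → E →L[ℝ] E) (k : g.Site → S → E →L[ℝ] E) (σ κ : ℝ), ‖s x‖ ≤ σ → 0 ≤ σ →
      ‖B9Eq360Vprime.kerOp blk k f (blk x)‖ ≤ κ * Sw →
      ‖s x (c (blk x) • B9Eq360Vprime.kerOp blk k f (blk x))‖ ≤ σ * (a₀ * (g.len (blk x) ^ 2)⁻¹) * (κ * Sw) := by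
    intro s k σ κ hs hσ hk
    calc ‖s x (c (blk x) • B9Eq360Vprime.kerOp blk k f (blk x))‖
        ≤ ‖s x‖ * ‖c (blk x) • B9Eq360Vprime.kerOp blk k f (blk x)‖ := ContinuousLinearMap.le_opNorm _ _
      _ = ‖s x‖ * (|c (blk x)| * ‖B9Eq360Vprime.kerOp blk k f (blk x)‖) := by rw [norm_smul, Real.norm_eq_abs]
      _ ≤ σ * ((a₀ * (g.len (blk x) ^ 2)⁻¹) * (κ * Sw)) :=
          mul_le_mul hs (mul_le_mul hcy hk (norm_nonneg _) (by have := hlen (blk x); positivity))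
            (mul_nonneg (abs_nonneg _) (norm_nonneg _)) hσ
      _ = σ * (a₀ * (g.len (blk x) ^ 2)⁻¹) * (κ * Sw) := by ring
  rw [B9Eq360VprimeLetters.avgOp_apply, hSweq]
  have t1 := term sF kQ (C * α₁) 1 (hsF x) hCα (by rw [one_mul]; simpa [one_mul] using hQ)
  have t2 := term sQ kF 1 (C * α₁) (hsQ x) zero_le_one hF
  have t3 := term sF kF (C * α₁) (C * α₁) (hsF x) hCα hF
  calc ‖sF x (c (blk x) • B9Eq360Vprime.kerOp blk kQ f (blk x)) + sQ x (c (blk x) • B9Eq360Vprime.kerOp blk kF f (blk x)) +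
        sF x (c (blk x) • B9Eq360Vprime.kerOp blk kF f (blk x))‖
      ≤ ‖sF x (c (blk x) • B9Eq360Vprime.kerOp blk kQ f (blk x))‖ + ‖sQ x (c (blk x) • B9Eq360Vprime.kerOp blk kF f (blk x))‖ +
        ‖sF x (c (blk x) • B9Eq360Vprime.kerOp blk kF f (blk x))‖ := norm_add₃_le
    _ ≤ C * α₁ * (a₀ * (g.len (blk x) ^ 2)⁻¹) * (1 * Sw) + 1 * (a₀ * (g.len (blk x) ^ 2)⁻¹) * (C * α₁ * Sw) +
        C * α₁ * (a₀ * (g.len (blk x) ^ 2)⁻¹) * (C * α₁ * Sw) := add_le_add (add_le_add t1 t2) t3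
    _ = a₀ * C * (2 + C * α₁) * α₁ * (g.len (blk x) ^ 2)⁻¹ * Sw := by ring

end BlockSum

/-! ## §4  Differences, the decaying shape of the averaging letter, and `hV0` of the FULL `V′(A)` in ℓ² -/

section Full

variable {𝔸 : Type*} [NormedRing 𝔸] [NormedAlgebra ℂ 𝔸] [CompleteSpace 𝔸] {ι : Type} [Fintype ι] [DecidableEq ι]
variable (b : Module.Basis ι ℝ 𝔸) {S : Type} [Fintype S] [DecidableEq S] {κ : Type} [Fintype κ]
variable (T : κ → Equiv.Perm S) (U : κ → S → 𝔸ˣ)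
variable {g : B9.Geometry} [Fintype g.Site] [DecidableEq g.Site] {Rr : ℝ} {H : Prop}

omit [DecidableEq g.Site] in
/-- ℓ² majorants pass to `−T` ([4] p. 232 «A summation preserves it also», with signs). [cite: Balaban1984PropagatorsII, (2.52) p.232 (bookkeeping, ours)] -/
theorem hasL2Majorant_neg {X : Type} [Fintype X] (blk : X → (toB6 g Rr H).Site) {T₀ : Module.End ℝ (X → ℝ)}
    {K : (toB6 g Rr H).Site → (toB6 g Rr H).Site → ℝ} (h : HasL2Majorant blk T₀ K) : HasL2Majorant blk (-T₀) K := by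
  intro y y' u hu
  have e : blockPiece blk y ((-T₀) u) = -(blockPiece blk y (T₀ u)) := by
    funext x
    simp only [blockPiece, LinearMap.neg_apply, Pi.neg_apply]
    split_ifs <;> simp
  rw [e, show -(blockPiece blk y (T₀ u)) = (-1 : ℝ) • blockPiece blk y (T₀ u) by simp, B6RandomWalkL2.l2n_smul]
  simpa using h y y' u hu

omit [DecidableEq g.Site] in
/-- ℓ² majorants of a difference: `T₁ − T₂ ≺ K₁ + K₂`. [cite: Balaban1984PropagatorsII, (2.52) p.232 (bookkeeping, ours)] -/
theorem hasL2Majorant_sub {X : Type} [Fintype X] (blk : X → (toB6 g Rr H).Site) {T₁ T₂ : Module.End ℝ (X → ℝ)}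
    {K₁ K₂ : (toB6 g Rr H).Site → (toB6 g Rr H).Site → ℝ} (h₁ : HasL2Majorant blk T₁ K₁) (h₂ : HasL2Majorant blk T₂ K₂) :
    HasL2Majorant blk (T₁ - T₂) (fun a a' => K₁ a a' + K₂ a a') := by
  rw [sub_eq_add_neg]
  exact B6RandomWalkL2.hasL2Majorant_add blk h₁ (hasL2Majorant_neg blk h₂)

omit [CompleteSpace 𝔸] [DecidableEq ι] [DecidableEq S] [Fintype κ] in
/-- **The averaging part in ℓ², common decaying shape** (twin of `B9Eq360VprimeLetters.hasMajorant_avgOp`): under `d(y,y) ≦ d₀`, `δ ≧ 0`,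
`conj b avgOp` has the block-ℓ² majorant `(a₀C(2 + Cα₁)M₂√#ι(Σ_i‖b_i‖²)^{1/2}e^{δd₀})·α₁·ℓ(y)⁻²·e^{−δd(y,y′)}`.
[cite: Balaban1985BackgroundPropagators, (3.60)–(3.61) p.402; Balaban1984PropagatorsII, Prop. 2.6 (2.140) p.247; derivation ours] -/
theorem hasL2Majorant_avgOp_decay (blk : S → g.Site) (kQ kF : g.Site → S → 𝔸 →L[ℝ] 𝔸) (sQ sF : S → 𝔸 →L[ℝ] 𝔸)
    (c w : g.Site → ℝ) (C α₁ a₀ M₂ d₀ δ : ℝ) (hw : ∀ y, 0 ≤ w y) (hcard : ∀ y, ((B9Eq360Vprime.block blk y).card : ℝ) * w y ≤ 1)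
    (hC : 0 ≤ C) (hα : 0 ≤ α₁) (ha₀ : 0 ≤ a₀) (hM₂ : 0 ≤ M₂) (hrepr : ∀ (v : 𝔸) (i : ι), |b.repr v i| ≤ M₂ * ‖v‖)
    (hlen : ∀ y : g.Site, 0 < g.len y) (hδ : 0 ≤ δ) (hd₀0 : ∀ y : g.Site, g.dist y y ≤ d₀)
    (hkQ : ∀ y x, blk x = y → ‖kQ y x‖ ≤ w y) (hkF : ∀ y x, blk x = y → ‖kF y x‖ ≤ C * α₁ * w y)
    (hsQ : ∀ x, ‖sQ x‖ ≤ 1) (hsF : ∀ x, ‖sF x‖ ≤ C * α₁) (hc : ∀ y, |c y| ≤ a₀ * (g.len y ^ 2)⁻¹) :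
    HasL2Majorant (g := toB6 g Rr H) (fun p : S × ι => blk p.1) (conj b (B9Eq360VprimeLetters.avgOp blk kQ kF sQ sF c))
      (fun y y' => (a₀ * C * (2 + C * α₁) * M₂ * Real.sqrt (Fintype.card ι) * Real.sqrt (∑ i, ‖b i‖ ^ 2) * Real.exp (δ * d₀)) *
        α₁ * (g.len y ^ 2)⁻¹ * Real.exp (-(δ * g.dist y y'))) := by
  refine hasL2Majorant_mono (g := toB6 g Rr H) _
    (hasL2Majorant_avgOp (Rr := Rr) (H := H) b blk kQ kF sQ sF c w C α₁ a₀ M₂ hw hcard hC hα ha₀ hM₂ hrepr hlen hkQ hkF hsQ hsF hc)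
    fun y y' => ?_
  change g.Site at y y'
  by_cases hyy : y = y'
  · subst hyy
    rw [if_pos rfl]
    have he : 1 ≤ Real.exp (δ * d₀) * Real.exp (-(δ * g.dist y y)) := by
      rw [← Real.exp_add]; exact Real.one_le_exp (by nlinarith [hd₀0 y])
    have h0 : 0 ≤ a₀ * C * (2 + C * α₁) * α₁ * (g.len y ^ 2)⁻¹ * M₂ * Real.sqrt (Fintype.card ι) * Real.sqrt (∑ i, ‖b i‖ ^ 2) := by
      have := hlen y; positivity
    calc a₀ * C * (2 + C * α₁) * α₁ * (g.len y ^ 2)⁻¹ * M₂ * Real.sqrt (Fintype.card ι) * Real.sqrt (∑ i, ‖b i‖ ^ 2)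
        = (a₀ * C * (2 + C * α₁) * α₁ * (g.len y ^ 2)⁻¹ * M₂ * Real.sqrt (Fintype.card ι) * Real.sqrt (∑ i, ‖b i‖ ^ 2)) * 1 :=
          (mul_one _).symm
      _ ≤ (a₀ * C * (2 + C * α₁) * α₁ * (g.len y ^ 2)⁻¹ * M₂ * Real.sqrt (Fintype.card ι) * Real.sqrt (∑ i, ‖b i‖ ^ 2)) *
            (Real.exp (δ * d₀) * Real.exp (-(δ * g.dist y y))) := mul_le_mul_of_nonneg_left he h0
      _ = _ := by ring
  · rw [if_neg hyy]
    have := hlen y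
    positivity

/-- ★ **`hV0` FOR THE FULL CONCRETE `V′(A)` IN ℓ²** (twin of `B9Eq360VprimeLetters.hasMajorant_V0_vPrime`): under (3.37) read blockwise for the letters of
`V⁰` as they occur and the (3.19)∕(3.58)∕(3.24)-shape bounds of the averaging letters, `conj b V⁰ − conj b avgOp` has the block-ℓ² majorant
`c″_C·α₁·ℓ⁻²·e^{−δd(y,y′)}` with `c″_C = ((2 + 8ρ²α₁)·|κ|·M₂(Σ_i‖b_i‖)·√((2|κ|+1)#ι) + a₀C(2 + Cα₁)·M₂√#ι(Σ_i‖b_i‖²)^{1/2})·e^{δd₀}` — the zeroth-order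
size `|V⁰| ≦ O(1)α₁(Lʲη)⁻²` of (3.61) for the FULL `V′` of (3.60), in the `L²` currency of (3.46).
[cite: Balaban1985BackgroundPropagators, (3.60)–(3.61) p.402 + (3.52) p.400 + (3.37) p.396; Balaban1984PropagatorsII, Prop. 2.6 (2.140) p.247; derivation ours] -/
theorem hasL2Majorant_V0_vPrime (blk : S → g.Site) {η : ℝ} (hη : 0 < η) (A : κ → S → 𝔸)
    (kQ kF : g.Site → S → 𝔸 →L[ℝ] 𝔸) (sQ sF : S → 𝔸 →L[ℝ] 𝔸) (c w : g.Site → ℝ) (ρ d₀ δ M₂ α₁ C a₀ : ℝ)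
    (hα₁ : 0 ≤ α₁) (hδ : 0 ≤ δ) (hM₂ : 0 ≤ M₂) (hrepr : ∀ (v : 𝔸) (i : ι), |b.repr v i| ≤ M₂ * ‖v‖)
    (hlen : ∀ y : g.Site, 0 < g.len y) (hsmall : ∀ y : g.Site, η * (α₁ * (g.len y)⁻¹) ≤ 1 / 4)
    (hA : ∀ μ x, ‖A μ x‖ ≤ α₁ * (g.len (blk x))⁻¹ ∧ ‖tauB T U μ (A μ) x‖ ≤ α₁ * (g.len (blk x))⁻¹)
    (h337s : ∀ μ x, ‖((η : ℂ)⁻¹) • covDstar T U μ (A μ) x‖ ≤ α₁ * (g.len (blk x) ^ 2)⁻¹)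
    (hρ : ∀ μ x, ‖((U μ x : 𝔸ˣ) : 𝔸)‖ ≤ ρ ∧ ‖(((U μ x)⁻¹ : 𝔸ˣ) : 𝔸)‖ ≤ ρ)
    (hd₀ : ∀ μ x, g.dist (blk x) (blk (T μ x)) ≤ d₀ ∧ g.dist (blk x) (blk ((T μ).symm x)) ≤ d₀)
    (hd₀0 : ∀ y : g.Site, g.dist y y ≤ d₀)
    (hw : ∀ y, 0 ≤ w y) (hcard : ∀ y, ((B9Eq360Vprime.block blk y).card : ℝ) * w y ≤ 1) (hC : 0 ≤ C) (ha₀ : 0 ≤ a₀)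
    (hkQ : ∀ y x, blk x = y → ‖kQ y x‖ ≤ w y) (hkF : ∀ y x, blk x = y → ‖kF y x‖ ≤ C * α₁ * w y)
    (hsQ : ∀ x, ‖sQ x‖ ≤ 1) (hsF : ∀ x, ‖sF x‖ ≤ C * α₁) (hc : ∀ y, |c y| ≤ a₀ * (g.len y ^ 2)⁻¹) :
    HasL2Majorant (g := toB6 g Rr H) (fun p : S × ι => blk p.1)
      (conj b (V0op T U η A) - conj b (B9Eq360VprimeLetters.avgOp blk kQ kF sQ sF c))
      (fun y y' => (((2 + 8 * ρ ^ 2 * α₁) * Fintype.card κ * M₂ * (∑ i, ‖b i‖) *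
            Real.sqrt (((2 * Fintype.card κ + 1) * Fintype.card ι : ℕ) : ℝ) +
          a₀ * C * (2 + C * α₁) * M₂ * Real.sqrt (Fintype.card ι) * Real.sqrt (∑ i, ‖b i‖ ^ 2)) * Real.exp (δ * d₀)) *
          α₁ * (g.len y ^ 2)⁻¹ * Real.exp (-(δ * g.dist y y'))) := by
  refine hasL2Majorant_mono (g := toB6 g Rr H) _
    (hasL2Majorant_sub (fun p : S × ι => blk p.1)
      (hasL2Majorant_V0op b T U blk hη A ρ d₀ δ M₂ α₁ hα₁ hδ hM₂ hrepr hlen hsmall hA h337s hρ hd₀ hd₀0)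
      (hasL2Majorant_avgOp_decay b blk kQ kF sQ sF c w C α₁ a₀ M₂ d₀ δ hw hcard hC hα₁ ha₀ hM₂ hrepr hlen hδ hd₀0 hkQ hkF hsQ
        hsF hc))
    fun y y' => le_of_eq ?_
  ring

end Full

end Literature.MathematicalPhysics.QuantumFieldTheory.Balaban1983to89.B9Ineq361L2Letters
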